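import Summits.QuantumAdvantage.QuantumAdvantage.Theorems.OrbitAveragingC

/-! # OrbitAveragingD — part 4/5 (mechanical split for landing of `OrbitAveraging`; content verbatim; scopes re-opened with their variables) -/

set_option linter.dupNamespace false
set_option linter.style.longLine false
set_option linter.unusedVariables false
noncomputable section
open scoped Classical

namespace Summit.QuantumAdvantage.QuantumAdvantage.Theorems.OrbitAveraging
open Finset
open Literature.Computability.QuantumComplexity Literature.Computability.QuantumComplexity.RingHLF
open Literature.Computability.MetaComplexity Literature.Computability.MetaComplexity.Smolensky
open Summit.QuantumAdvantage.AdviceFreeQNC0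
open Summit.QuantumAdvantage.QuantumAdvantage.Theorems (flat)
open Summit.QuantumAdvantage.QuantumAdvantage.Theorems.RingPeriodFold (cov covStrat covStrat_mem_lowDeg cov_eq_covStrat)
open Summit.QuantumAdvantage.QuantumAdvantage.Theorems.SpreadBridge (JointStrategy winAllSet sum_card_filter_update
  fibre_decrement decay_le_half)
variable {n : ℕ}

section NormalFormLaw
open Summit.QuantumAdvantage.AdviceFreeQNC0.RingSymmetry (shift rot_mod rot_rot rot_apply rel_rot shift_bijective
  rot_injective shift_shift rot_eq_rot_of_mod_eq card_filter_comp_of_bijective card_filter_shift)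
open Summit.QuantumAdvantage.AdviceFreeQNC0.Symmetrization (pre pre_shift shift_pre)
open Summit.QuantumAdvantage.QuantumAdvantage.Theorems (unflat flat_unflat)
open Summit.QuantumAdvantage.QuantumAdvantage.Theorems.RingLeaderElection3 (ι3 coord3 coord3_mem fireCount3 exists_election3)
open Summit.QuantumAdvantage.QuantumAdvantage.Theorems.RingSymmetrization3 (leader fires_iff_eq_leader election_params)

section Construction
variable {m n : ℕ}

/-- `P̃_{j,i}`: `P_{j,i}` evaluated at the canonical tuple (invariant under every ring rotation). -/
def ptil (e : CubeFn (ZMod 3) n) (s : Fin m → ℕ) (P : JointStrategy m n) (j : Fin m) (i : Fin n) :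
    CubeFn (ZMod 3) (m * n) :=
  fun u => P j i (flat (canonT e s u))

/-- THE SYMMETRISED JOINT STRATEGY `P'_{s⃗}`: ring `j`, output `b`: `Σ_a e(rot_a u_j) · P̃_{j, pre a s_j b}(u)`. -/
def psym (e : CubeFn (ZMod 3) n) (s : Fin m → ℕ) (P : JointStrategy m n) : JointStrategy m n :=
  fun j b => fun u => ∑ a : Fin n, e (rot a.val (unflat u j)) * ptil e s P j (pre a (s j) b) u

/-! ### degrees -/

/-- OrbitAveragingD helper `e_proj_mem` (decomp-qadv land package; see the module docstring). -/
theorem e_proj_mem {De : ℕ} {e : CubeFn (ZMod 3) n} (he : e ∈ lowDeg (ZMod 3) n De) (a : ℕ) (t : Fin m) :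
    (fun u : Fin (m * n) → Bool => e (rot a (unflat u t))) ∈ lowDeg (ZMod 3) (m * n) De := by
  have h := Smolensky.comp_subst_mem_lowDeg (F := ZMod 3)
    (fun u : Fin (m * n) → Bool => rot a (unflat u t)) (fun c => Or.inr ⟨finProdFinEquiv (t, shift n a c), fun u => rfl⟩) he
  exact h

/-- OrbitAveragingD helper `iota_proj_mem` (decomp-qadv land package; see the module docstring). -/
theorem iota_proj_mem (a : ℕ) (t : Fin m) (c : Fin n) :
    (fun u : Fin (m * n) → Bool => ι3 (rot a (unflat u t) c)) ∈ lowDeg (ZMod 3) (m * n) 1 := by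
  have h := coord3_mem (n := m * n) (finProdFinEquiv (t, shift n a c))
  exact h

/-- OrbitAveragingD helper `qc_mem` (decomp-qadv land package; see the module docstring). -/
theorem qc_mem {De : ℕ} {e : CubeFn (ZMod 3) n} (he : e ∈ lowDeg (ZMod 3) n De) (s : Fin m → ℕ)
    (t : Fin m) (c : Fin n) : qc e s t c ∈ lowDeg (ZMod 3) (m * n) (De + 1) := by
  have e1 : qc e s t c = ∑ a : Fin n,
      ((fun u : Fin (m * n) → Bool => e (rot a.val (unflat u t))) *
        fun u => ι3 (rot (a.val + s t) (unflat u t) c)) := by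
    funext u
    rw [Finset.sum_apply]
    rfl
  rw [e1]
  exact Submodule.sum_mem _ fun a _ => mul_mem_lowDeg_add (e_proj_mem he a.val t) (iota_proj_mem _ t c)

/-- over `𝔽₃` the indicator of `[q² = 1]` IS `q·q` (squares are `0` or `1`). -/
theorem ite_sq_eq_one (q : ZMod 3) : (if decide (q ^ 2 = 1) = true then (1 : ZMod 3) else 0) = q * q := by
  revert q; decide

/-- OrbitAveragingD helper `canon_ind_mem` (decomp-qadv land package; see the module docstring). -/
theorem canon_ind_mem {De : ℕ} {e : CubeFn (ZMod 3) n} (he : e ∈ lowDeg (ZMod 3) n De) (s : Fin m → ℕ)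
    (k : Fin (m * n)) :
    (fun u : Fin (m * n) → Bool => if flat (canonT e s u) k = true then (1 : ZMod 3) else 0) ∈
      lowDeg (ZMod 3) (m * n) ((De + 1) + (De + 1)) := by
  have e1 : (fun u : Fin (m * n) → Bool => if flat (canonT e s u) k = true then (1 : ZMod 3) else 0) =
      qc e s (finProdFinEquiv.symm k).1 (finProdFinEquiv.symm k).2 *
        qc e s (finProdFinEquiv.symm k).1 (finProdFinEquiv.symm k).2 := by
    funext u
    rw [Pi.mul_apply]
    exact ite_sq_eq_one _
  rw [e1]
  exact mul_mem_lowDeg_add (qc_mem he s _ _) (qc_mem he s _ _)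

/-- OrbitAveragingD helper `ptil_mem` (decomp-qadv land package; see the module docstring). -/
theorem ptil_mem {D De : ℕ} {e : CubeFn (ZMod 3) n} (he : e ∈ lowDeg (ZMod 3) n De) (s : Fin m → ℕ)
    {P : JointStrategy m n} (hP : ∀ j i, P j i ∈ lowDeg (ZMod 3) (m * n) D) (j : Fin m) (i : Fin n) :
    ptil e s P j i ∈ lowDeg (ZMod 3) (m * n) (D * ((De + 1) + (De + 1))) :=
  Smolensky.comp_mem_lowDeg_of_coord_mul (fun u => flat (canonT e s u)) (canon_ind_mem he s) (hP j i)

/-- OrbitAveragingD helper `psym_mem` (decomp-qadv land package; see the module docstring). -/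
theorem psym_mem {D De : ℕ} {e : CubeFn (ZMod 3) n} (he : e ∈ lowDeg (ZMod 3) n De) (s : Fin m → ℕ)
    {P : JointStrategy m n} (hP : ∀ j i, P j i ∈ lowDeg (ZMod 3) (m * n) D) (j : Fin m) (b : Fin n) :
    psym e s P j b ∈ lowDeg (ZMod 3) (m * n) (De + D * ((De + 1) + (De + 1))) := by
  have e1 : psym e s P j b = ∑ a : Fin n,
      ((fun u : Fin (m * n) → Bool => e (rot a.val (unflat u j))) * ptil e s P j (pre a (s j) b)) := by
    funext u
    rw [Finset.sum_apply]
    rfl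
  rw [e1]
  exact Submodule.sum_mem _ fun a _ => mul_mem_lowDeg_add (e_proj_mem he a.val j) (ptil_mem he s hP j _)

/-! ### exact invariance of the canonical coordinates and equivariance of `psym` (ALL inputs) -/

/-- OrbitAveragingD helper `shift_val` (decomp-qadv land package; see the module docstring). -/
theorem shift_val (r : ℕ) (a : Fin n) : (shift n r a).val = (a.val + r) % n := rfl

/-- reindexing a sum over `Fin n` by a shift. -/
theorem sum_shift (r : ℕ) (g : Fin n → ZMod 3) : ∑ a : Fin n, g (shift n r a) = ∑ a : Fin n, g a :=
  (shift_bijective r).sum_comp g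

/-- OrbitAveragingD helper `qc_update_rot` (decomp-qadv land package; see the module docstring). -/
theorem qc_update_rot (e : CubeFn (ZMod 3) n) (s : Fin m → ℕ) (t : Fin m) (c : Fin n)
    (X : Fin m → Fin n → Bool) (j : Fin m) (y : Fin n → Bool) (r : ℕ) :
    qc e s t c (flat (Function.update X j (rot r y))) = qc e s t c (flat (Function.update X j y)) := by
  unfold qc
  simp only [unflat_flat]
  by_cases htj : t = j
  · subst htj
    simp only [Function.update_self, rot_rot]
    rw [← sum_shift r (fun a : Fin n => e (rot a.val y) * ι3 (rot (a.val + s t) y c))]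
    refine sum_congr rfl fun a _ => ?_
    simp only [shift_val]
    rw [rot_mod, rot_eq_rot_of_mod_eq (show (a.val + s t + r) % n = ((a.val + r) % n + s t) % n by
      rw [Nat.add_mod ((a.val + r) % n), Nat.mod_mod, ← Nat.add_mod]; ring_nf)]
  · simp only [Function.update_of_ne htj]

/-- OrbitAveragingD helper `canonT_update_rot` (decomp-qadv land package; see the module docstring). -/
theorem canonT_update_rot (e : CubeFn (ZMod 3) n) (s : Fin m → ℕ) (X : Fin m → Fin n → Bool) (j : Fin m)
    (y : Fin n → Bool) (r : ℕ) :
    canonT e s (flat (Function.update X j (rot r y))) = canonT e s (flat (Function.update X j y)) := by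
  funext t c
  simp only [canonT, qc_update_rot]

/-- OrbitAveragingD helper `ptil_update_rot` (decomp-qadv land package; see the module docstring). -/
theorem ptil_update_rot (e : CubeFn (ZMod 3) n) (s : Fin m → ℕ) (P : JointStrategy m n) (j' : Fin m) (i : Fin n)
    (X : Fin m → Fin n → Bool) (j : Fin m) (y : Fin n → Bool) (r : ℕ) :
    ptil e s P j' i (flat (Function.update X j (rot r y))) = ptil e s P j' i (flat (Function.update X j y)) := by
  simp only [ptil, canonT_update_rot]

/-- `pre` is translation-covariant: `pre (a+r) s (b+r) = pre a s b`. -/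
theorem pre_shift_shift (a b : Fin n) (s r : ℕ) : pre (shift n r a) s (shift n r b) = pre a s b := by
  apply (shift_bijective (n := n) ((shift n r a).val + s)).1
  rw [shift_pre]
  apply Fin.ext
  rw [shift_val, shift_val, shift_val]
  have h1 : ((pre a s b).val + ((a.val + r) % n + s)) % n = ((pre a s b).val + (a.val + s) + r) % n := by
    have h := Nat.ModEq.add_left (pre a s b).val (Nat.ModEq.add_right s (Nat.mod_modEq (a.val + r) n))
    rw [Nat.ModEq] at h
    rw [h]
    congr 1
    ring
  have h2 : ((pre a s b).val + (a.val + s)) % n = b.val := by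
    have h := congrArg Fin.val (shift_pre a s b)
    rw [shift_val] at h
    exact h
  rw [h1, Nat.add_mod ((pre a s b).val + (a.val + s)) r n, h2, Nat.add_mod_mod]

/-- OWN-RING COVARIANCE of `psym`, as an identity of values. -/
theorem psym_own (e : CubeFn (ZMod 3) n) (s : Fin m → ℕ) (P : JointStrategy m n)
    (X : Fin m → Fin n → Bool) (j : Fin m) (y : Fin n → Bool) (r : ℕ) (b : Fin n) :
    psym e s P j b (flat (Function.update X j (rot r y))) =
      psym e s P j (shift n r b) (flat (Function.update X j y)) := by
  unfold psym
  simp only [ptil_update_rot]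
  simp only [unflat_flat, Function.update_self, rot_rot]
  rw [← sum_shift r (fun a : Fin n => e (rot a.val y) * ptil e s P j (pre a (s j) (shift n r b))
    (flat (Function.update X j y)))]
  refine sum_congr rfl fun a _ => ?_
  rw [shift_val, rot_mod, pre_shift_shift]

/-- FOREIGN INVARIANCE of `psym`, as an identity of values. -/
theorem psym_foreign (e : CubeFn (ZMod 3) n) (s : Fin m → ℕ) (P : JointStrategy m n)
    (X : Fin m → Fin n → Bool) (j t : Fin m) (htj : t ≠ j) (y : Fin n → Bool) (r : ℕ) (b : Fin n) :
    psym e s P t b (flat (Function.update X j (rot r y))) = psym e s P t b (flat (Function.update X j y)) := by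
  unfold psym
  simp only [ptil_update_rot, unflat_flat, Function.update_of_ne htj]

/-- OrbitAveragingD helper `psym_equivariant` (decomp-qadv land package; see the module docstring). -/
theorem psym_equivariant (e : CubeFn (ZMod 3) n) (s : Fin m → ℕ) (P : JointStrategy m n) :
    (∀ (X : Fin m → Fin n → Bool) (j : Fin m) (y : Fin n → Bool) (r : ℕ) (i : Fin n),
      decide (psym e s P j i (flat (Function.update X j (rot r y))) = 1) =
        decide (psym e s P j (RingSymmetry.shift n r i) (flat (Function.update X j y)) = 1)) ∧
    (∀ (X : Fin m → Fin n → Bool) (j t : Fin m), t ≠ j → ∀ (y : Fin n → Bool) (i : Fin n),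
      decide (psym e s P t i (flat (Function.update X j (rot 1 y))) = 1) =
        decide (psym e s P t i (flat (Function.update X j y)) = 1)) :=
  ⟨fun X j y r i => by rw [psym_own], fun X j t htj y i => by rw [psym_foreign e s P X j t htj]⟩

end Construction

/-! ### §8.2 win transport on ALL-GOOD tuples -/

section Transport

variable {m n : ℕ}

/-- the phase-rotated canonical tuple `Z_t = rot_{a_t + s_t} X_t` (`a_t` = ring `t`'s leader). -/
def zT (hn : 0 < n) (e : CubeFn (ZMod 3) n) (s : Fin m → ℕ) (X : Fin m → Fin n → Bool) : Fin m → Fin n → Bool :=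
  fun t => rot ((leader hn e (X t)).val + s t) (X t)

/-- OrbitAveragingD helper `qc_flat_good` (decomp-qadv land package; see the module docstring). -/
theorem qc_flat_good (hn : 0 < n) {e : CubeFn (ZMod 3) n} (he01 : ∀ y, e y = 0 ∨ e y = 1) (s : Fin m → ℕ)
    {X : Fin m → Fin n → Bool} {t : Fin m} (ht : fireCount3 e (X t) = 1) (c : Fin n) :
    qc e s t c (flat X) = ι3 (rot ((leader hn e (X t)).val + s t) (X t) c) := by
  unfold qc
  simp only [unflat_flat]
  rw [Finset.sum_eq_single (leader hn e (X t))]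
  · rw [(fires_iff_eq_leader hn ht _).2 rfl, one_mul]
  · intro a _ ha
    have h0 : e (rot a.val (X t)) = 0 := by
      rcases he01 (rot a.val (X t)) with h | h
      · exact h
      · exact absurd ((fires_iff_eq_leader hn ht a).1 h) ha
    rw [h0, zero_mul]
  · intro h; exact absurd (mem_univ _) h

/-- OrbitAveragingD helper `decide_iota_sq` (decomp-qadv land package; see the module docstring). -/
theorem decide_iota_sq (b : Bool) : decide (ι3 b ^ 2 = (1 : ZMod 3)) = b := by
  cases b <;> simp [ι3]

/-- OrbitAveragingD helper `canonT_flat_good` (decomp-qadv land package; see the module docstring). -/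
theorem canonT_flat_good (hn : 0 < n) {e : CubeFn (ZMod 3) n} (he01 : ∀ y, e y = 0 ∨ e y = 1) (s : Fin m → ℕ)
    {X : Fin m → Fin n → Bool} (hX : ∀ t, fireCount3 e (X t) = 1) : canonT e s (flat X) = zT hn e s X := by
  funext t c
  simp only [canonT, qc_flat_good hn he01 s (hX t), decide_iota_sq]
  rfl

/-- OrbitAveragingD helper `psym_flat_good` (decomp-qadv land package; see the module docstring). -/
theorem psym_flat_good (hn : 0 < n) {e : CubeFn (ZMod 3) n} (he01 : ∀ y, e y = 0 ∨ e y = 1) (s : Fin m → ℕ)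
    (P : JointStrategy m n) {X : Fin m → Fin n → Bool} (hX : ∀ t, fireCount3 e (X t) = 1) (j : Fin m) (b : Fin n) :
    psym e s P j b (flat X) = P j (pre (leader hn e (X j)) (s j) b) (flat (zT hn e s X)) := by
  unfold psym
  simp only [unflat_flat]
  rw [Finset.sum_eq_single (leader hn e (X j))]
  · rw [(fires_iff_eq_leader hn (hX j) _).2 rfl, one_mul]
    simp only [ptil, canonT_flat_good hn he01 s hX]
  · intro a _ ha
    have h0 : e (rot a.val (X j)) = 0 := by
      rcases he01 (rot a.val (X j)) with h | h
      · exact h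
      · exact absurd ((fires_iff_eq_leader hn (hX j) a).1 h) ha
    rw [h0, zero_mul]
  · intro h; exact absurd (mem_univ _) h

/-- **WIN TRANSPORT**: on an all-good tuple, `P'_{s⃗}` wins ring `j` at `X` iff `P` wins ring `j` at `Z`. -/
theorem win_transport (hn : 0 < n) {e : CubeFn (ZMod 3) n} (he01 : ∀ y, e y = 0 ∨ e y = 1) (s : Fin m → ℕ)
    (P : JointStrategy m n) {X : Fin m → Fin n → Bool} (hX : ∀ t, fireCount3 e (X t) = 1) (j : Fin m) :
    RingHLF.Rel (X j) (fun b => decide (psym e s P j b (flat X) = 1)) ↔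
      RingHLF.Rel (zT hn e s X j) (fun i => decide (P j i (flat (zT hn e s X)) = 1)) := by
  set k := (leader hn e (X j)).val + s j with hk
  rw [← rel_rot k (X j)]
  have e1 : rot k (fun b => decide (psym e s P j b (flat X) = 1)) =
      fun i => decide (P j i (flat (zT hn e s X)) = 1) := by
    funext i
    rw [rot_apply, psym_flat_good hn he01 s P hX j, hk, pre_shift]
  rw [e1]
  rfl

end Transport

/-! ### §8.3 phase averaging by two bijections -/

section Counting

variable {m n : ℕ}

/-- the all-good set: every ring's input has exactly one firing rotation. -/
def goodT (e : CubeFn (ZMod 3) n) : Finset (Fin m → Fin n → Bool) :=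
  univ.filter fun X => ∀ t, fireCount3 e (X t) = 1

/-- coordinatewise rotation of a tuple. -/
def rotT (r : Fin m → Fin n) (X : Fin m → Fin n → Bool) : Fin m → Fin n → Bool :=
  fun t => rot (r t).val (X t)

/-- OrbitAveragingD helper `fireCount3_rot` (decomp-qadv land package; see the module docstring). -/
theorem fireCount3_rot (e : CubeFn (ZMod 3) n) (r : ℕ) (x : Fin n → Bool) :
    fireCount3 e (rot r x) = fireCount3 e x := by
  unfold fireCount3
  have h : (univ.filter fun b : Fin n => e (rot b.val (rot r x)) = 1) =
      univ.filter fun b : Fin n => e (rot (shift n r b).val x) = 1 := by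
    refine filter_congr fun b _ => ?_
    rw [rot_rot, shift_val, rot_mod]
  rw [h]
  exact card_filter_shift r (fun b : Fin n => e (rot b.val x) = 1)

/-- OrbitAveragingD helper `mem_goodT_rotT` (decomp-qadv land package; see the module docstring). -/
theorem mem_goodT_rotT (e : CubeFn (ZMod 3) n) (r : Fin m → Fin n) (X : Fin m → Fin n → Bool) :
    rotT r X ∈ goodT (m := m) e ↔ X ∈ goodT (m := m) e := by
  simp only [goodT, mem_filter, mem_univ, true_and, rotT, fireCount3_rot]

/-- OrbitAveragingD helper `rotT_bijective` (decomp-qadv land package; see the module docstring). -/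
theorem rotT_bijective (r : Fin m → Fin n) : Function.Bijective (rotT r) := by
  have hinj : Function.Injective (rotT r) := fun X Y h => funext fun t => rot_injective (r t).val (congrFun h t)
  exact ⟨hinj, Finite.surjective_of_injective hinj⟩

/-- OrbitAveragingD helper `shiftT_bijective` (decomp-qadv land package; see the module docstring). -/
theorem shiftT_bijective (k : Fin m → ℕ) :
    Function.Bijective (fun s : Fin m → Fin n => fun t => shift n (k t) (s t)) := by
  have hinj : Function.Injective (fun s : Fin m → Fin n => fun t => shift n (k t) (s t)) :=
    fun s s' h => funext fun t => (shift_bijective (k t)).1 (congrFun h t)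
  exact ⟨hinj, Finite.surjective_of_injective hinj⟩

/-- OrbitAveragingD helper `zT_eq_rotT` (decomp-qadv land package; see the module docstring). -/
theorem zT_eq_rotT (hn : 0 < n) (e : CubeFn (ZMod 3) n) (s : Fin m → Fin n) (X : Fin m → Fin n → Bool) :
    zT hn e (fun t => (s t).val) X = rotT (fun t => shift n (leader hn e (X t)).val (s t)) X := by
  funext t
  simp only [zT, rotT, shift_val]
  rw [rot_mod, Nat.add_comm]

/-- **PHASE AVERAGING** (exact): summed over all phase vectors, the all-good tuples whose phase-rotated
canonical tuple lies in `W` number `n^m · #(good ∩ W)` — two bijections (translate the phases by the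
leader vector; rotate the tuple), no orbit sizes. -/
theorem phase_sum (hn : 0 < n) (e : CubeFn (ZMod 3) n) (W : Finset (Fin m → Fin n → Bool)) :
    ∑ s : Fin m → Fin n, (univ.filter fun X : Fin m → Fin n → Bool =>
        X ∈ goodT (m := m) e ∧ zT hn e (fun t => (s t).val) X ∈ W).card =
      Fintype.card (Fin m → Fin n) *
        (univ.filter fun X : Fin m → Fin n → Bool => X ∈ goodT (m := m) e ∧ X ∈ W).card := by
  -- swap, translate the phases, swap back, rotate the tuple
  have h1 : ∀ X : Fin m → Fin n → Bool,
      (univ.filter fun s : Fin m → Fin n => X ∈ goodT (m := m) e ∧ zT hn e (fun t => (s t).val) X ∈ W).card =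
        (univ.filter fun r : Fin m → Fin n => X ∈ goodT (m := m) e ∧ rotT r X ∈ W).card := by
    intro X
    have e2 : (univ.filter fun s : Fin m → Fin n => X ∈ goodT (m := m) e ∧ zT hn e (fun t => (s t).val) X ∈ W) =
        univ.filter fun s : Fin m → Fin n =>
          X ∈ goodT (m := m) e ∧ rotT ((fun s' : Fin m → Fin n => fun t => shift n (leader hn e (X t)).val (s' t)) s) X ∈ W := by
      refine filter_congr fun s _ => ?_
      rw [zT_eq_rotT]
    rw [e2]
    exact card_filter_comp_of_bijective _ (shiftT_bijective _)
      (fun r : Fin m → Fin n => X ∈ goodT (m := m) e ∧ rotT r X ∈ W)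
  have h2 : ∀ r : Fin m → Fin n,
      (univ.filter fun X : Fin m → Fin n → Bool => X ∈ goodT (m := m) e ∧ rotT r X ∈ W).card =
        (univ.filter fun X : Fin m → Fin n → Bool => X ∈ goodT (m := m) e ∧ X ∈ W).card := by
    intro r
    have e3 : (univ.filter fun X : Fin m → Fin n → Bool => X ∈ goodT (m := m) e ∧ rotT r X ∈ W) =
        univ.filter fun X : Fin m → Fin n → Bool => rotT r X ∈ goodT (m := m) e ∧ rotT r X ∈ W := by
      refine filter_congr fun X _ => ?_
      rw [mem_goodT_rotT]
    rw [e3]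
    exact card_filter_comp_of_bijective _ (rotT_bijective r)
      (fun Y : Fin m → Fin n → Bool => Y ∈ goodT (m := m) e ∧ Y ∈ W)
  calc ∑ s : Fin m → Fin n, (univ.filter fun X : Fin m → Fin n → Bool =>
          X ∈ goodT (m := m) e ∧ zT hn e (fun t => (s t).val) X ∈ W).card
      = ∑ X : Fin m → Fin n → Bool, (univ.filter fun s : Fin m → Fin n =>
          X ∈ goodT (m := m) e ∧ zT hn e (fun t => (s t).val) X ∈ W).card := by
        simp only [card_filter]
        rw [Finset.sum_comm]
    _ = ∑ X : Fin m → Fin n → Bool, (univ.filter fun r : Fin m → Fin n =>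
          X ∈ goodT (m := m) e ∧ rotT r X ∈ W).card := sum_congr rfl fun X _ => h1 X
    _ = ∑ r : Fin m → Fin n, (univ.filter fun X : Fin m → Fin n → Bool =>
          X ∈ goodT (m := m) e ∧ rotT r X ∈ W).card := by
        simp only [card_filter]
        rw [Finset.sum_comm]
    _ = ∑ _r : Fin m → Fin n, (univ.filter fun X : Fin m → Fin n → Bool =>
          X ∈ goodT (m := m) e ∧ X ∈ W).card := sum_congr rfl fun r _ => h2 r
    _ = _ := by rw [sum_const, card_univ, smul_eq_mul]


end Counting
end NormalFormLaw
end Summit.QuantumAdvantage.QuantumAdvantage.Theorems.OrbitAveraging
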